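import Summits.ABC.IUTFork.Cor312TeamAGapWitness
import HarnessLib

/-!
# TEAM A gap witness, part B: the quantities, the bridge hypotheses, and the isolation theorem

Record-only file (D-0012) of the abc-iut cell (Cor. 3.12 STRATEGY TEAM A «direct III§3», D-0067, seat
abc-iut-c312-9 = A1, row A-4 of `HOME/plan/C312-TEAMS.md`); TAKES NO SIDE; proof-only companion of
`Cor312TeamAGapWitness` (which constructs `gapFull` / `gapSetting` and proves the typed Theorem 3.11 there,
`gapFull_statement`). THIS file computes the two printed quantities of the witness (`−|log(Θ)| = −2`,
`−|log(q)| = −1`), discharges ALL bridge hypotheses (`gapSetting_bridgeHyps : BridgeHyps gapSetting`) and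
the positivity `|log(q)| > 0`, shows the typed Corollary 3.12 FAILS (`gapSetting_not_statement`), shows the
Step (xi) readings fail as they must (`gapSetting_not_qRegion_subset_thetaHull`), and states the
**TEAM A GAP ISOLATION** (`thm311_bridgeHyps_not_imp_statement`): granting the typed Theorem 3.11 (i) ∧
(ii) ∧ (iii) in full, every bridge hypothesis, and `|log(q)| > 0`, the typed Corollary 3.12 still has a
countermodel — so any kernel derivation of Cor. 3.12 over these interfaces must consume an input at the
strength of the Step (xi) readings (R1/R2/R3 of `Cor312StatementBridge`, R4 `IsoContainment` of
`Cor312ReadingIso`), the content the printed proof locates at Step (xi-f) "then follows formally" (kurims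
`paper:url-4b091feeb646` p. 184 l. 19–29). HONEST SCOPE as in part A: interface-level; whether a reading is
provable for the ASSEMBLED real setting from the frozen definitions is Team A's residual GAP statement.
[claim: Mochizuki2012, status: disputed] [cite: ScholzeStix2018, §2.2 pp. 9–10]
[cite: LANA2026Report, §9.2 p. 46]
-/

noncomputable section

namespace Summit.ABC

namespace IUTFork

namespace Cor312Vol

namespace GapWitness

open Thm311 Cor312 Cor312.Checks Literature.IUT.LogThetaLattice

/-! ## 5. The two quantities: `−|log(Θ)| = −2`, `−|log(q)| = −1` -/

/-- The (Ind3)-enlarged Θ-pilot region is `{0}` in every packet. [folklore] -/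
theorem gap_thetaRegion3 (j : toyIndex.Label) (vQ : toyIndex.VQ) :
    gapSetting.thetaRegion3 j vQ = {0} := by
  show (⋃ _ : ℤ, ({0} : Set (toyShells.Packet j vQ))) = {0}
  exact Set.iUnion_const _

/-- The possible images of the Θ-pilot object are exactly `{0}` (every indeterminacy is `ℚ`-linear, hence
fixes `0`). [folklore] -/
theorem gap_mem_possibleImages_iff (j : toyIndex.Label) (vQ : toyIndex.VQ)
    (U : Set (toyShells.Packet j vQ)) :
    U ∈ gapSetting.possibleImages j vQ ↔ U = {0} := by
  constructor
  · rintro ⟨Φ, -, rfl⟩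
    rw [gap_thetaRegion3, Set.image_singleton, map_zero]
    rfl
  · rintro rfl
    exact gap_thetaRegion3 j vQ ▸ gapSetting.thetaRegion3_mem_possibleImages j vQ

/-- The union of the possible images is `{0}`. [folklore] -/
theorem gap_sUnion_possibleImages (j : toyIndex.Label) (vQ : toyIndex.VQ) :
    ⋃₀ gapSetting.possibleImages j vQ = ({0} : Set (toyShells.Packet j vQ)) := by
  ext x
  simp only [Set.mem_sUnion]
  constructor
  · rintro ⟨U, hU, hx⟩
    rwa [(gap_mem_possibleImages_iff j vQ U).1 hU] at hx
  · intro hx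
    exact ⟨{0}, (gap_mem_possibleImages_iff j vQ _).2 rfl, hx⟩

/-- The packet hull `^{n,∘}𝒰_{j,v_ℚ}` of the gap witness is `{0}`. [folklore] -/
theorem gap_thetaHull (j : toyIndex.Label) (vQ : toyIndex.VQ) :
    gapSetting.thetaHull j vQ = ({0} : Set (toyShells.Packet j vQ)) := by
  refine Set.Subset.antisymm ?_ ?_
  · show (gapFrame _).hull (⋃₀ gapSetting.possibleImages j vQ) ⊆ {0}
    exact gapFrame_hull_of_subset (gap_sUnion_possibleImages j vQ).le
  · exact ((gap_sUnion_possibleImages j vQ).symm.le).trans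
      ((gapFrame (toyShells.Packet j vQ)).subset_hull (⋃₀ gapSetting.possibleImages j vQ))

/-- Every union of possible images admits its hull. [folklore] -/
theorem gap_hullDefined (j : toyIndex.Label) (vQ : toyIndex.VQ) :
    gapSetting.HullDefined j vQ := ⟨trivial, trivial⟩

/-- The local Θ-volume is `−2` in every packet. [folklore] -/
theorem gap_thetaLocal (j : toyIndex.Label) (vQ : toyIndex.VQ) :
    gapSetting.thetaLocal j vQ = ((-2 : ℝ) : WithTop ℝ) := by
  unfold Setting.thetaLocal
  rw [if_pos (gap_hullDefined j vQ)]
  show ((gapData.logvol j vQ (gapSetting.thetaHull j vQ) : ℝ) : WithTop ℝ) = _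
  rw [gap_thetaHull, gapData_logvol_of_subset subset_rfl]

/-- The local `q`-volume is `−1` in every packet. [folklore] -/
theorem gap_qLocal (j : toyIndex.Label) (vQ : toyIndex.VQ) : gapSetting.qLocal j vQ = -1 :=
  gapData_logvol_univ j vQ

/-- The gap witness is `ThetaFinite`. [folklore] -/
theorem gap_thetaFinite : gapSetting.ThetaFinite :=
  ⟨fun i vQ => by rw [gap_thetaLocal]; exact WithTop.coe_ne_top, fun _ => Set.toFinite _⟩

/-- `−|log(Θ)| = −2` in the gap witness. [folklore] -/
theorem gap_negLogTheta : gapSetting.negLogTheta = ((-2 : ℝ) : WithTop ℝ) := by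
  unfold Setting.negLogTheta
  rw [if_pos gap_thetaFinite]
  have h : ∀ i : Fin toyIndex.lstar,
      (∑ᶠ vQ : toyIndex.VQ, (gapSetting.thetaLocal (Setting.labelSucc i) vQ).untopD 0) = -2 := by
    intro i
    have h1 : (fun vQ : toyIndex.VQ => (gapSetting.thetaLocal (Setting.labelSucc i) vQ).untopD 0) =
        fun _ => (-2 : ℝ) := by
      funext vQ
      rw [gap_thetaLocal, WithTop.untopD_coe]
    rw [h1, finsum_unique]
  simp only [h]
  exact congrArg _ (processionNormalized_const (by decide) (-2))

/-- `−|log(q)| = −1` in the gap witness. [folklore] -/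
theorem gap_negLogQ : gapSetting.negLogQ = -1 := by
  unfold Setting.negLogQ
  have h : ∀ i : Fin toyIndex.lstar,
      (∑ᶠ vQ : toyIndex.VQ, gapSetting.qLocal (Setting.labelSucc i) vQ) = -1 := by
    intro i
    have h1 : (fun vQ : toyIndex.VQ => gapSetting.qLocal (Setting.labelSucc i) vQ) =
        fun _ => (-1 : ℝ) := by
      funext vQ
      exact gap_qLocal _ vQ
    rw [h1, finsum_unique]
  simp only [h]
  exact processionNormalized_const (by decide) (-1)

/-! ## 6. All bridge hypotheses hold; the Corollary fails -/

/-- **All bridge hypotheses of `Cor312StatementBridge` hold in the gap witness.** [folklore] -/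
theorem gapSetting_bridgeHyps : BridgeHyps gapSetting where
  mono := fun i vQ A B _ _ hAB => gapData_logvol_mono hAB
  image_adm := fun _ _ _ _ => trivial
  image_fin := fun _ => Set.toFinite _
  hul_nonempty := fun j vQ H hH => by
    rcases hH with rfl | rfl
    · exact ⟨0, rfl⟩
    · exact ⟨0, Set.mem_univ 0⟩
  theta_nonempty := fun i vQ => by
    rw [gap_thetaRegion3]
    exact ⟨0, rfl⟩
  finite := gap_thetaFinite

/-- "`|log(q)| > 0`" holds in the gap witness (`−|log(q)| = −1 < 0`). [folklore] -/
theorem gapSetting_absLogQPos : gapSetting.AbsLogQPos := by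
  show gapSetting.negLogQ < 0
  rw [gap_negLogQ]; norm_num

/-- **The typed Corollary 3.12 FAILS in the gap witness**: `−|log(q)| = −1 > −2 = −|log(Θ)|`. [folklore] -/
theorem gapSetting_not_statement : ¬ gapSetting.Statement := by
  rintro ⟨-, hle⟩
  rw [gap_negLogQ, gap_negLogTheta, WithTop.coe_le_coe] at hle
  norm_num at hle

/-- The Step (xi) readings fail in the gap witness, as they must: the `q`-pilot image (everything) is not
contained in the packet hull `{0}`. (Hence Reading 3 and Reading 4 fail as well: every subset of the hull
has log-volume `−2 ≠ −1`.) [folklore] -/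
theorem gapSetting_not_qRegion_subset_thetaHull :
    ¬ ∀ (i : Fin toyIndex.lstar) (vQ : toyIndex.VQ),
        gapSetting.qRegion (Setting.labelSucc i) vQ ⊆ gapSetting.thetaHull (Setting.labelSucc i) vQ := by
  intro h
  have h0 := h ⟨0, by decide⟩ ()
  rw [gap_thetaHull] at h0
  exact univ_not_subset_zero (Setting.labelSucc ⟨0, by decide⟩) () h0

/-! ## 7. The isolation, as one statement -/

/-- **TEAM A GAP ISOLATION ([IUTchIII] Cor. 3.12, Step (xi)).** There is an instantiation in which the
typed Theorem 3.11 (i) ∧ (ii) ∧ (iii) holds IN FULL, every bridge hypothesis of the verbatim statement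
holds, `|log(q)| > 0` — and the typed Corollary 3.12 is FALSE. Consequently the typed interfaces of
Theorem 3.11 (c312-1 A–D, every hypothesis granted) together with the bridge hypotheses do NOT entail the
typed Corollary 3.12: any kernel derivation of the Corollary over these interfaces must consume an
additional input at the strength of the Step (xi) readings (R1/R2/R3 of `Cor312StatementBridge`, R4 of
`Cor312ReadingIso`) — the content the printed proof locates at Step (xi-f) "then follows formally"
(p. 184 l. 19–29). The intended-model question — whether such a reading is provable for the ASSEMBLED real
setting from the frozen definitions — is exactly Team A's residual GAP statement. [folklore] -/
theorem thm311_bridgeHyps_not_imp_statement :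
    ∃ (T : ThetaIndex) (F : FullSituation T) (P : Setting F.toLatticeSituation.toSituation),
      F.Statement ∧ BridgeHyps P ∧ P.AbsLogQPos ∧ ¬ P.Statement :=
  ⟨toyIndex, gapFull, gapSetting, gapFull_statement, gapSetting_bridgeHyps, gapSetting_absLogQPos,
    gapSetting_not_statement⟩

end GapWitness

end Cor312Vol

end IUTFork

end Summit.ABC

end
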